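import Literature.MathematicalPhysics.QuantumFieldTheory.Balaban1983to89.B9B8AveragingJunction

/-!
# `Balaban1983to89.B9B8DeltaPrimeJunction` — JUNCTION J-B, FILE 2: the averaging TERM `Q′*aQ′` of `Δ′_a(U)` ([B9] (3.24)) on the two carriers —
# def-Y's `Σ_w a(z,w) R(U(Γ_{z,c})U(Γ_{c,w})) Λ(w)` (`Node00.OpsYDeltaPrimeA.deltaPrimeAY` at `parKnitY`) `=` the [Balaban1985RegularSpaces] knit's
# `Q′_j(U₀)ᵀ (a_j(Lʲ)^{d−1} · Q′_j(U₀) λ)` (`B8Eq138LandauZd.QprimeT ∕ QT` ∘ `B7Eq78Linearization.QprimeIter`), EXACTLY, and the full `Δ′_a` junction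
# on constant-level members (the trivial domain sequence `Ω₁ = … = Ω_n = T_η` of sub-row G-B9-LETTERS)

statement-level skeleton of published theorems with citation tags; proofs where landed; nothing here is a claim about the
Yang–Mills mass gap

T. Bałaban, *Propagators for lattice gauge theories in a background field*, Commun. Math. Phys. **99** (1985) 389–434
[`Balaban1985BackgroundPropagators`, "[B9]"]; T. Bałaban, *Spaces of regular gauge field configurations on a lattice and gauge fixing conditions*,
Commun. Math. Phys. **99** (1985) 75–102 [`Balaban1985RegularSpaces`, "[B8]"].  PDFs held (`paper:balaban1985-cmp99-background-propagators`, journal page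
= PDF page + 388).

THE PRINT (verbatim, [B9] p. 394).  *«Δ′_a(U) = Δ_U + Σ_j a_j(Lʲη)^{−2} Q′_j(U)\* 1_{Λ_j} Q′_j(U) … (3.24)»* with (3.19) *«(Q′_j(U)λ)(y) =
Σ_{x∈Bʲ(y)} L^{−jd}R(U(Γ^{(j)}_{y,x}))λ(x)»* and (3.25) p. 395 *«the operator Δ′_a is positive»* (the adjoint `Q′_j(U)\*` for the pairing with the
block weights `(Lʲη)^d`).  [B8] p. 77: *«we admit the case where some domains Ω_j are equal to T_η»*; sub-row G-B9-LETTERS reads Thms 3.1–3.3 on `T_η`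
for the TRIVIAL domain sequence, where `𝔅 = Λ_n = T^{(n)}` is ONE level — the knit's truncation-`n` letters `QT L n (torusLam n)` ((E4) `qpT_reads`)
and `QprimeIter (zdBlocking d L) (bgT L U₀)` ((E5) `qp_reads` of `B8Thm2TorusLetters.LettersAt`).

CITATION HEADER (lean-in-tree rule).  Cell `lit-balaban`, sub-row G-B9-LETTERS, junction module **J-B** (lead RULING #3, 2026-08-28T01:14Z) → seat
`lit-balaban-p33` gen 91, file 2 of `lit-balaban-p33/JAB-STATEMENTS.md` option (a).  REUSED BY NAME: J-B file 1 (`parKnitY`, `parOfT_corner_right`,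
`parOfT_blkCornerY`, `knitT_of_blkOf`, `QpY_parKnitY_eq_QprimeIter`, `sum_block_R_parKnitY_eq`, the block dictionary), J-A file 1 (`covLap_liftY`,
`boxEquiv`-chart), def-Y (`deltaPrimeAY_apply`, `avgCoeffY`, `avgTrY`, `levC`, `W_eq`), w1 (`avgCoeffY_eq_ite`, `cornerY_levY_eq`), the knit (`QprimeT`, `QT`, `qprimeT1`, `torusLam`).

WHAT THIS FILE PROVES (sorry-free; one definition with body — the level-weight operator `awOp`; everything else theorems).
* §1 THE KNIT's TRANSPOSE, SECOND FORM: `(Q′_j(U₀)ᵀν)(x) = (L^{−(d+1)})ʲ · R(U(Γ^{(j)}_{y,x}))⁻¹ ν(y)`, `y = blockMap^{[j]} x` (`QprimeT_eq_compT`); at the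
  torus member's constraint sets `torusLam n` the multi-level transpose `QT L n (torusLam n)` IS the level-`n` transpose (`QT_torusLam_eq`).
* §2 (def-Y's averaging coefficient by blocks is w1's `B9Thm311DeltaPrimeSymm.avgCoeffY_eq_ite`, reused) ★★ THE AVERAGING TERM AT `parKnitY` IN THE
  KNIT's CURRENCY, for EVERY member, background, `Λ`, site `z` (level `j = j(z)`, block `s`):
  `Σ_w a(z,w) • R(avgTrY parKnitY U z w) Λ(w) = (levC_j · W_s²) • (Q′_jᵀ (Q′_j liftFun(Λ ∘ chart)))(z)` (`avgTerm_parKnitY_eq`), where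
  `levC_j · W_s² = a_j (Lʲ)^{−2} (Lʲ)^{d+1}` is print's level weight `a_j(Lʲη)^{d−2}`·`η²` at `η = 1` (`levC_mul_W_sq`).
* §3 ★★★ THE `Δ′_a` JUNCTION ON CONSTANT-LEVEL MEMBERS (`∀ z, j(z) = n`): with the level-weight operator `awOp c`, `(awOp c μ) j y = c_j • μ j y`, and the
  weights `c_j = η⁻²·levC_j·W_j²`,
  `covLap η U₀ f (z) + QT L n (torusLam n) U₀ (awOp c (j ↦ Q′_j(U₀) f)) (z) = η⁻² • (Δ′_a(U) Λ)(z)`, `f = liftFun (Λ ∘ chart)`, `U₀ = liftCfg U`, at every box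
  point `z` (`deltaPrime_junction_at_box`) — the consumer's pinned operator of (E1)∕(E3)–(E5) IS `η⁻²`× def-Y's `deltaPrimeAY i (parKnitY i) U` there.

HONEST SCOPE.  (i) Pointwise AT BOX POINTS `x = z.1`; the extension to all `x ∈ ℤ^{d+1}` (both sides `N₀`-periodic) and the transported Green's
operator `Gp` with the bounded right-inverse law (E1) are J-B file 3 (needs the knit's translation covariance `B8TorusShift*` at period `N₀ ∈ LⁿL·ℤ`).
(ii) The `Δ′_a` junction needs the CONSTANT-LEVEL hypothesis (the knit's truncation-`n` letters average at ONE level everywhere); the `Q′`-junction of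
file 1 and §2 here do not.  (iii) No estimate of [B8]∕[B9] is proved or asserted; positivity ∕ coercivity of `Δ′_a` at `parKnitY` are file 3;
count-neutral (no new named fact); nothing continuum, nothing about OS axioms or the mass gap.  No `sorry`, no `axiom`, no `instance`, no `notation`.
Seat `lit-balaban-p33` gen 91, 2026-08-28.
-/

noncomputable section

namespace Literature.MathematicalPhysics.QuantumFieldTheory.Balaban1983to89.B9B8DeltaPrimeJunction

open B7Prop1Explicit renaming Site → LSite
open Literature.MathematicalPhysics.QuantumLattice (blockSites blockBase blockMap mem_blockSites_iff)
open B7Eq78Linearization (conjR conjR_apply conjR_smul_real QprimeIter zdBlocking)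
open B7Prop3GeneralRotated (conjR_mul_left)
open B8Eq119TwistedAxial (bgT)
open B8Eq138LandauZd (covLap qprimeT1 QprimeT QT QprimeT_zero)
open B8Thm4TorusAt (torusLam torusLam_self torusLam_of_ne)
open B10Eq27TorusAxialLog (transl)
open B9Eq39Adjoint (R R_mul R_smul R_add R_zero)
open B4Reflection242 (boxDom mem_boxDom blk avgK)
open B6MultiLevelBoxOperator (N0 levC aPrinted)
open B6Ineq268MultiLevelBox (W W_eq W_pos)
open B6Geom246MultiLevelBox (bset blkOf blkOf_val blkOf_eq_iff_blk exists_blkOf_eq lev_eq_of_blkOf_eq)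
open B6GlobalChartV1 (PV boxEquiv)
open B6KLevelCensusIndexV1 (KIdx)
open B9B8CarrierDictionary (liftFun liftFun_apply liftCfg covLap_liftY)
open B9Thm311DeltaPrimeSymm (cornerY_levY_eq avgCoeffY_eq_ite)
open B9B8AveragingKernelZd (compT compT_succ QprimeIter_zd_eq_sum_blockIter)
open B9B8AveragingJunction (blk_eq_blockMap blockMap_iterate knitT parOfT parKnitY knitT_of_blkOf parOfT_blkCornerY parOfT_corner_right
  bgT_blockBase QpY_parKnitY_eq_QprimeIter sum_block_R_parKnitY_eq boxEquiv_transl_of_mem levY_of_blkOf)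
open Node00

variable {d ℓ : ℕ} {hd : 1 ≤ d + 1} {hL : Odd (ℓ + 1) ∧ 1 < ℓ + 1} {b₀ b₁ : ℝ}

/-! ## §1 The knit's transpose `Q′_j(U₀)ᵀ`, second form, and the single-level reading of `QT` at `torusLam n` -/

section Knit

variable {D : ℕ} {𝔸 : Type*} [NormedRing 𝔸] [NormedAlgebra ℂ 𝔸] [CompleteSpace 𝔸]

/-- ★ **(3.19)ᵀ, SECOND FORM**: the `j`-fold transpose averaging is ONE kernel entry with the INVERSE composite transporter —
`(Q′_j(U₀)ᵀν)(x) = (L⁻ᵈ)ʲ · R(T^{(j)}(y, x))⁻¹ ν(y)`, `y = blockMap^{[j]} x` the level-`j` ancestor of `x`.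
[cite: Balaban1985BackgroundPropagators, (3.19) p.393, (3.24)–(3.25) pp.394–395 («Q′_j(U)\*»)] -/
theorem QprimeT_eq_compT (L : ℕ) (U₀ : (Fin D → ℤ) → Fin D → 𝔸ˣ) :
    ∀ (j : ℕ) (ν : (Fin D → ℤ) → 𝔸) (x : Fin D → ℤ),
      QprimeT L U₀ j ν x = ((((L : ℝ) ^ D)⁻¹) ^ j) • conjR (compT L (bgT L U₀) j ((blockMap L)^[j] x) x)⁻¹ (ν ((blockMap L)^[j] x))
  | 0, ν, x => by simp [QprimeT, compT, conjR]
  | j + 1, ν, x => by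
      show QprimeT L U₀ j (qprimeT1 L U₀ j ν) x = _
      rw [QprimeT_eq_compT L U₀ j, qprimeT1, conjR_smul_real, smul_smul, ← pow_succ, compT_succ, mul_inv_rev, conjR_mul_left,
        Function.iterate_succ_apply']

/-- the transpose averaging is real-linear: `Q′_jᵀ(r·ν) = r·Q′_jᵀν`. [cite: Balaban1985BackgroundPropagators, (3.19) p.393, bookkeeping] -/
theorem QprimeT_real_smul (L : ℕ) (U₀ : (Fin D → ℤ) → Fin D → 𝔸ˣ) (j : ℕ) (r : ℝ) (ν : (Fin D → ℤ) → 𝔸) (x : Fin D → ℤ) :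
    QprimeT L U₀ j (r • ν) x = r • QprimeT L U₀ j ν x := by
  rw [QprimeT_eq_compT, QprimeT_eq_compT, Pi.smul_apply, conjR_smul_real, smul_smul, smul_smul, mul_comm]

/-- ★ **AT THE TORUS MEMBER's CONSTRAINT SETS the multi-level transpose is the level-`n` transpose**: `Λ_j = ∅` (`j ≠ n`), `Λ_n = T^{(n)}`, so
`QT L n (torusLam n) U₀ μ = Q′_n(U₀)ᵀ (μ n)` — the letter pinned by (E4) `qpT_reads`. [cite: Balaban1985RegularSpaces, (1.5)–(1.6) p.77, p.77 («Ω_j = T_η»), (1.29) p.81; Balaban1985BackgroundPropagators, (3.24) p.394] -/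
theorem QT_torusLam_eq (L n : ℕ) (U₀ : (Fin D → ℤ) → Fin D → 𝔸ˣ) (μ : ℕ → (Fin D → ℤ) → 𝔸) (x : Fin D → ℤ) :
    QT L n (torusLam n) U₀ μ x = QprimeT L U₀ n (μ n) x := by
  unfold QT
  rw [Finset.sum_eq_single n]
  · rw [torusLam_self, Set.indicator_univ]
  · intro j _ hjn
    have h0 : (torusLam (d := D) n j).indicator (μ j) = 0 := by rw [torusLam_of_ne hjn, Set.indicator_empty']
    rw [h0]
    exact QprimeT_zero L U₀ j x
  · intro h
    exact absurd (Finset.self_mem_range_succ n) h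

/-- **THE LEVEL-WEIGHT OPERATOR `𝔄`** of the consumer's letters (`Aw` of `B8Thm2TorusLetters.LettersAt`): multiplication of the level-`j` component by a
real weight `c_j` (print's `a_j(Lʲη)^{d−2}`; the letter is free in the consumer, any weights with the laws are admitted). [cite: Balaban1985BackgroundPropagators, (3.24) p.394 («a_j(Lʲη)^{−2}»)] -/
def awOp {X : Type*} (c : ℕ → ℝ) : (ℕ → X → 𝔸) →ₗ[ℂ] (ℕ → X → 𝔸) where
  toFun μ := fun j y => ((c j : ℝ) : ℂ) • μ j y
  map_add' μ μ' := by funext j y; simp [smul_add]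
  map_smul' a μ := by funext j y; simp [smul_comm a]

omit [CompleteSpace 𝔸] in
/-- the weight operator, evaluated. [cite: Balaban1985BackgroundPropagators, (3.24) p.394, bookkeeping] -/
@[simp] theorem awOp_apply {X : Type*} (c : ℕ → ℝ) (μ : ℕ → X → 𝔸) (j : ℕ) (y : X) : awOp c μ j y = ((c j : ℝ) : ℂ) • μ j y := rfl

end Knit

/-! ## §2 def-Y's averaging coefficient by blocks and the averaging term at `parKnitY` in the knit's currency -/

section AvgTerm

variable {𝔸 : Type} [NormedRing 𝔸] [NormedAlgebra ℂ 𝔸] [CompleteSpace 𝔸]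
variable (i : KIdx d ℓ hd hL b₀ b₁)

/-- print's level weight in lattice units: `levC_j · W_j² = a_j (Lʲ)^{−2} (Lʲ)^{d+1}` (`= a_j(Lʲη)^{d−2}·η²` at `η = 1`; `W_j = L^{j(d+1)}`).
[cite: Balaban1985BackgroundPropagators, (3.24) p.394 («a_j(Lʲη)^{−2}», block weight (Lʲη)^d); Balaban1984PropagatorsII, (2.14) p.225, (2.69) p.235] -/
theorem levC_mul_W_sq (s : BlkY i) :
    levC d ℓ (aPrinted ℓ 1) s.1.1 * (W i.D.toDomains s * W i.D.toDomains s)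
      = aPrinted ℓ 1 s.1.1 * (((((ℓ : ℝ) + 1)) ^ s.1.1) ^ 2)⁻¹ * ((((ℓ : ℝ) + 1)) ^ s.1.1) ^ (d + 1) := by
  have hW : W i.D.toDomains s ≠ 0 := (W_pos _ s).ne'
  rw [levC, W_eq] at *
  field_simp

/-- the averaging term of def-Y's `Δ′_a(U)Λ` at `z` (the `kernelTrOpY` part of `deltaPrimeAY_apply`), by name. [cite: Balaban1985BackgroundPropagators, (3.24) p.394, dictionary] -/
theorem deltaPrimeAY_sub_lapS (par : SiteParY 𝔸 i) (U : CfgY 𝔸 i) (Λ : SiteY i → 𝔸) (z : SiteY i) :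
    deltaPrimeAY i par U Λ z - lapS i U Λ z = ∑ w, ((avgCoeffY i z w : ℝ) : ℂ) • R (avgTrY i par U z w) (Λ w) := by
  rw [deltaPrimeAY_apply, add_sub_cancel_left]

/-- ★ def-Y's AVERAGING TERM AT `parKnitY`, BLOCK FORM: `Σ_w a(z,w) R(U(Γ_{z,c})U(Γ_{c,w}))Λ(w) = levC_j • R(T^{(j)}(y,z))⁻¹ Σ_{w ∈ s} R(T^{(j)}(y,w))Λ(w)`
(`s = (j, y)` the block of `z`, `c` its corner; the transport `z ← c ← w` of (3.24)'s `Q′*…Q′`). [cite: Balaban1985BackgroundPropagators, (3.19) p.393, (3.24) p.394] -/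
theorem avgTerm_parKnitY_block (U : CfgY 𝔸 i) (Λ : SiteY i → 𝔸) (z : SiteY i) :
    ∑ w, ((avgCoeffY i z w : ℝ) : ℂ) • R (avgTrY i (parKnitY i) U z w) (Λ w)
      = ((levC d ℓ (aPrinted ℓ 1) (levY i z) : ℝ) : ℂ) •
          R (knitT i (bgT (ℓ + 1) (liftCfg U)) z)⁻¹
            (∑ w ∈ Finset.univ.filter (fun w : SiteY i => blkOf i.D.toDomains w = blkOf i.D.toDomains z),
              R (parKnitY i U (blkCornerY i (blkOf i.D.toDomains z)) w) (Λ w)) := by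
  have hT : ∀ j y, bgT (ℓ + 1) (liftCfg U) j y (blockBase (ℓ + 1) y) = 1 := fun j y => bgT_blockBase (ℓ + 1) (liftCfg U) j y
  -- the transport `z ← c`: `parKnitY U z c = (knitT z)⁻¹`
  have hzc : parKnitY i U z (cornerY i (levY i z) z) = (knitT i (bgT (ℓ + 1) (liftCfg U)) z)⁻¹ := parOfT_corner_right i _ hT z
  have hRsum : ∀ (t : Finset (SiteY i)) (g : SiteY i → 𝔸),
      R (knitT i (bgT (ℓ + 1) (liftCfg U)) z)⁻¹ (∑ w ∈ t, g w) = ∑ w ∈ t, R (knitT i (bgT (ℓ + 1) (liftCfg U)) z)⁻¹ (g w) :=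
    fun t g => map_sum (⟨⟨R _, R_zero _⟩, R_add _⟩ : 𝔸 →+ 𝔸) g t
  rw [hRsum, Finset.smul_sum, Finset.sum_filter]
  refine Finset.sum_congr rfl fun w _ => ?_
  rw [avgCoeffY_eq_ite]
  split_ifs with h
  · rw [avgTrY, hzc, B9Eq39Adjoint.R_mul, cornerY_levY_eq]
  · rw [Complex.ofReal_zero, zero_smul]

/-- ★★ **def-Y's AVERAGING TERM AT `parKnitY` IS THE KNIT's `Q′_jᵀ(c_j · Q′_j λ)`**: for EVERY member, background `U`, site function `Λ` and box site `z`
(level `j = j(z)`, block `s`), `Σ_w a(z,w) • R(avgTrY parKnitY U z w) Λ(w) = (levC_j·W_s²) • (Q′_j(U₀)ᵀ (Q′_j(U₀) f))(z)`, `f = liftFun (Λ ∘ chart)`,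
`U₀ = liftCfg U` — (3.24)'s `a_j(Lʲη)^{−2}Q′_j(U)\*1_{Λ_j}Q′_j(U)` read on the two carriers. [cite: Balaban1985BackgroundPropagators, (3.24) p.394, (3.19) p.393; Balaban1985RegularSpaces, (1.29) p.81] -/
theorem avgTerm_parKnitY_eq (U : CfgY 𝔸 i) (Λ : SiteY i → 𝔸) (z : SiteY i) :
    ∑ w, ((avgCoeffY i z w : ℝ) : ℂ) • R (avgTrY i (parKnitY i) U z w) (Λ w)
      = ((levC d ℓ (aPrinted ℓ 1) (levY i z) * (W i.D.toDomains (blkOf i.D.toDomains z) * W i.D.toDomains (blkOf i.D.toDomains z)) : ℝ) : ℂ) •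
          QprimeT (ℓ + 1) (liftCfg U) (levY i z)
            (QprimeIter (zdBlocking (d + 1) (ℓ + 1)) (bgT (ℓ + 1) (liftCfg U)) (levY i z) (liftFun (Λ ∘ ⇑(boxEquiv i.hN)))) z.1 := by
  set s : BlkY i := blkOf i.D.toDomains z with hs
  have hzs : blkOf i.D.toDomains z = s := rfl
  have hlev : levY i z = s.1.1 := levY_of_blkOf i hzs
  have hanc : (blockMap (ℓ + 1))^[s.1.1] z.1 = s.1.2 := by
    rw [blockMap_iterate, ← blk_eq_blockMap]; exact (blkOf_eq_iff_blk i.D.toDomains).1 hzs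
  rw [avgTerm_parKnitY_block, sum_block_R_parKnitY_eq, hlev, QprimeT_eq_compT, hanc, ← QpY_parKnitY_eq_QprimeIter,
    ← knitT_of_blkOf i (bgT (ℓ + 1) (liftCfg U)) hzs, R_smul, smul_smul, ← Complex.coe_smul, smul_smul, ← Complex.ofReal_mul,
    ← Complex.ofReal_mul, ← B9B8AveragingJunction.inv_W_eq_pow i s]
  have hW : W i.D.toDomains s ≠ 0 := (W_pos _ s).ne'
  have hc : levC d ℓ (aPrinted ℓ 1) s.1.1 * W i.D.toDomains s
      = levC d ℓ (aPrinted ℓ 1) s.1.1 * (W i.D.toDomains s * W i.D.toDomains s) * (W i.D.toDomains s)⁻¹ := by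
    field_simp
  rw [hc]
  rfl

end AvgTerm

/-! ## §3 The `Δ′_a` junction at box points, constant-level members -/

section DeltaPrime

variable {𝔸 : Type} [NormedRing 𝔸] [NormedAlgebra ℂ 𝔸] [CompleteSpace 𝔸]
variable (i : KIdx d ℓ hd hL b₀ b₁)

/-- **THE JUNCTION WEIGHTS**: `c_j = η⁻² · levC_j · W_j²` (`= η⁻² a_j (Lʲ)^{d−1}`; the `η⁻²` carries the lattice-unit convention of def-Y's `Δ′_a` to the
knit's `η`-units, cf. `B9B8CarrierDictionary.covLap_liftY`). [cite: Balaban1985BackgroundPropagators, (3.24) p.394; Balaban1985RegularSpaces, (1.1) p.76] -/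
def cKnit (η : ℝ) (j : ℕ) : ℝ :=
  (η⁻¹ * η⁻¹) * (levC d ℓ (aPrinted ℓ 1) j * (((((ℓ : ℝ) + 1)) ^ j) ^ (d + 1) * ((((ℓ : ℝ) + 1)) ^ j) ^ (d + 1)))

/-- the junction weight at the level of a block is `η⁻² · levC_{j_s} · W_s²`. [cite: Balaban1985BackgroundPropagators, (3.24) p.394, bookkeeping] -/
theorem cKnit_eq (η : ℝ) (s : BlkY i) :
    cKnit (d := d) (ℓ := ℓ) η s.1.1 = (η⁻¹ * η⁻¹) * (levC d ℓ (aPrinted ℓ 1) s.1.1 * (W i.D.toDomains s * W i.D.toDomains s)) := by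
  rw [cKnit, W_eq]

/-- ★★★ **THE `Δ′_a` JUNCTION AT BOX POINTS, CONSTANT-LEVEL MEMBERS.**  For a member whose level function is constant `= n` (the trivial domain sequence
`Ω₁ = … = Ω_n = T_η` of sub-row G-B9-LETTERS), every background `U`, `η`, site function `Λ` and box site `z`: the [B8]-knit's operator of (E1) — the
covariant Laplacian `covLap η U₀` ((E3)) plus `QT L n (torusLam n) U₀` ((E4)) of the weighted ((3.24) weights `c_j`) levels of `QprimeIter (zdBlocking) (bgT L U₀)`
((E5)) — applied to the periodic lift `f = liftFun (Λ ∘ chart)` at `U₀ = liftCfg U` and read at `z`, IS `η⁻²`× def-Y's `Δ′_a(U)Λ` at the knit letter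
`parKnitY`, read at `z`. [cite: Balaban1985BackgroundPropagators, (3.23)–(3.24) p.394; Balaban1985RegularSpaces, (1.1) p.76, (1.29) p.81, p.77 («Ω_j = T_η»)] -/
theorem deltaPrime_junction_at_box {n : ℕ} (hlev : ∀ z : SiteY i, levY i z = n) (η : ℝ) (U : CfgY 𝔸 i) (Λ : SiteY i → 𝔸) (z : SiteY i) :
    covLap η (liftCfg U) (liftFun (Λ ∘ ⇑(boxEquiv i.hN))) z.1
        + QT (ℓ + 1) n (torusLam n) (liftCfg U)
            (awOp (cKnit (d := d) (ℓ := ℓ) η) fun j => QprimeIter (zdBlocking (d + 1) (ℓ + 1)) (bgT (ℓ + 1) (liftCfg U)) j (liftFun (Λ ∘ ⇑(boxEquiv i.hN)))) z.1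
      = (η⁻¹ * η⁻¹) • deltaPrimeAY i (parKnitY i) U Λ z := by
  have hz : boxEquiv i.hN (transl 0 z.1) = z := boxEquiv_transl_of_mem i z.2
  rw [covLap_liftY, hz, deltaPrimeAY_apply, smul_add, QT_torusLam_eq]
  congr 1
  -- the averaging term
  have hsm : (awOp (𝔸 := 𝔸) (cKnit (d := d) (ℓ := ℓ) η) fun j =>
        QprimeIter (zdBlocking (d + 1) (ℓ + 1)) (bgT (ℓ + 1) (liftCfg U)) j (liftFun (Λ ∘ ⇑(boxEquiv i.hN)))) n
      = (cKnit (d := d) (ℓ := ℓ) η n : ℝ) • QprimeIter (zdBlocking (d + 1) (ℓ + 1)) (bgT (ℓ + 1) (liftCfg U)) n (liftFun (Λ ∘ ⇑(boxEquiv i.hN))) := by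
    funext y; rw [awOp_apply, Pi.smul_apply, Complex.coe_smul]
  rw [hsm, QprimeT_real_smul, avgTerm_parKnitY_eq, hlev z, ← Complex.coe_smul, ← Complex.coe_smul, smul_smul, ← Complex.ofReal_mul]
  congr 1
  have hs : (blkOf i.D.toDomains z).1.1 = n := (levY_of_blkOf i rfl).symm.trans (hlev z)
  rw [← hs, cKnit_eq i η (blkOf i.D.toDomains z)]

end DeltaPrime

end Literature.MathematicalPhysics.QuantumFieldTheory.Balaban1983to89.B9B8DeltaPrimeJunction

end
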